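import Mathlib
import HarnessLib
import Summits.HubbardSuperconductivity.HubbardSuperconductivity.Theorems.ThermalWedgeTwSeededEnsembleEquivalenceRRectangleLimit
import Summits.HubbardSuperconductivity.HubbardSuperconductivity.Theorems.ThermalWedgeTwSeededEnsembleEquivalenceRTorusBox

/-!
# Route `ThermalWedge`, crux `TwSeededEnsembleEquivalenceR` (stmt-HubbardSuperconductivity-15581):
# thermodynamic limit of the d-wave-SOURCED torus pressure (registered stub `stub_sourcedPressureLimit`)

Support file (`--supports stmt-HubbardSuperconductivity-15581`; no definition; the route file is NOT imported).
Last layer: for `L ≥ 3` the torus pair field `Δ_d` and the free-boundary pair sum `P` have the same bond weights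
except on the `≤ 4L` wrap-around ordered pairs (`twR_pairWeight_eq_of_adj_iff`: a bond weight of `Δ_d` at `(x, y)` is
`Σ_e 1[y ≡ x + e (mod L)] ĝ_d(e)/√2`; when the torus and box adjacencies of `(x,y)` agree, the congruence forces
`y - x = e` because distinct unit steps are incongruent mod `L ≥ 3`), whence
`‖dWaveSourceTorus L U μ h - H_box‖ ≤ (8 + 96|h|)L`, `|log Z_torus - log Z_box| ≤ β(8 + 96|h|)L`, and with the
free-boundary limit of `…RRectangleLimit.lean`:

* **`twR_sourcedPressureLimit`** — for all real `β > 0`, `U`, `μ`, `h` the sourced torus pressure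
  `log Re Z_β(dWaveSourceTorus L U μ h)/(βL²)` converges as `L → ∞` (stated in the `ε–L₀` form registered as the
  stub `stub_sourcedPressureLimit` of the line `Sketch` of this crux; periodic and free boundary conditions have the
  same limit).

Ruelle, *Statistical Mechanics: Rigorous Results* (1969) §2.2–2.3 (thermodynamic limit of the pressure of quantum
lattice systems; independence of boundary conditions); for lattice fermions with even local interactions via the
CAR-algebra factorisation of the trace state, Bratteli–Robinson II §5.2.2 / §6.2.4. [folklore]
-/

set_option linter.dupNamespace false

noncomputable section

namespace Summit.HubbardSuperconductivity.HubbardSuperconductivity.Theorems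

open Literature.MathematicalPhysics.QuantumLattice Literature.Barriers.HubbardSuperconductivity
  Literature.Probability.LatticeModels Matrix Finset HubbardWave0 WcbcsBoxTiling Filter
open scoped BigOperators Matrix.Norms.L2Operator Topology

/-! ### Unit steps: coordinates and projections to the torus -/

section Steps

/-- Coordinates of unit steps lie in `{-1, 0, 1}`. [folklore] -/
theorem twR_unitSteps_apply {e : Site 2} (he : e ∈ unitSteps) (i : Fin 2) : -1 ≤ e i ∧ e i ≤ 1 := by
  simp only [unitSteps, Finset.mem_insert, Finset.mem_singleton] at he
  rcases he with rfl | rfl | rfl | rfl <;> fin_cases i <;> simp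

/-- Unit steps project to `± Pi.single i 1` on the torus. [folklore] -/
theorem twR_proj_unitSteps (L : ℕ) {e : Site 2} (he : e ∈ unitSteps) :
    (∃ i : Fin 2, Torus.proj L e = Pi.single i 1) ∨ (∃ i : Fin 2, Torus.proj L e = -Pi.single i 1) := by
  simp only [unitSteps, Finset.mem_insert, Finset.mem_singleton] at he
  rcases he with rfl | rfl | rfl | rfl
  · exact Or.inl ⟨0, by funext j; fin_cases j <;> simp [Torus.proj]⟩
  · exact Or.inr ⟨0, by funext j; fin_cases j <;> simp [Torus.proj]⟩
  · exact Or.inl ⟨1, by funext j; fin_cases j <;> simp [Torus.proj]⟩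
  · exact Or.inr ⟨1, by funext j; fin_cases j <;> simp [Torus.proj]⟩

end Steps

/-! ### Bond weights of the torus pair field versus the box weights -/

section Weights

variable {L : ℕ} [NeZero L]

/-- The torus-shift condition in terms of the torus coordinates. [folklore] -/
theorem twR_ofTorusSite_add_eq_iff (x y : FermionTorus 2 L) (e : Site 2) :
    FermionTorus.ofTorusSite (FermionTorus.toTorusSite x + Torus.proj L e) = y ↔
      FermionTorus.toTorusSite y = FermionTorus.toTorusSite x + Torus.proj L e := by
  constructor
  · intro h; rw [← h, FermionTorus.toTorusSite_ofTorusSite]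
  · intro h; rw [← h, FermionTorus.ofTorusSite_toTorusSite]

omit [NeZero L] in
/-- A torus shift by a unit step is a torus bond (for `L ≥ 2`). [folklore] -/
theorem twR_torusAdj_of_shift (hL : 2 ≤ L) {x y : FermionTorus 2 L} {e : Site 2} (he : e ∈ unitSteps)
    (h : FermionTorus.toTorusSite y = FermionTorus.toTorusSite x + Torus.proj L e) : (fermionTorusGraph 2 L).Adj x y := by
  haveI : Fact (1 < L) := ⟨hL⟩
  rw [fermionTorusGraph_adj, torusGraph_adj_iff]
  rcases twR_proj_unitSteps L he with ⟨i, hi⟩ | ⟨i, hi⟩ <;> rw [hi] at h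
  · refine ⟨fun heq => ?_, Or.inl ⟨i, h⟩⟩
    rw [heq] at h
    have h1 := congrFun h i
    simp only [Pi.add_apply, Pi.single_eq_same] at h1
    exact one_ne_zero (by linear_combination -h1 : (1 : ZMod L) = 0)
  · refine ⟨fun heq => ?_, Or.inr ⟨i, by rw [h]; simp⟩⟩
    rw [heq] at h
    have h1 := congrFun h i
    simp only [Pi.add_apply, Pi.neg_apply, Pi.single_eq_same] at h1
    exact one_ne_zero (by linear_combination h1 : (1 : ZMod L) = 0)

omit [NeZero L] in
/-- Box bonds have coordinate differences in `{-1, 0, 1}`. [folklore] -/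
theorem twR_boxAdj_apply {x y : FermionTorus 2 L} (h : ((zdGraph 2).comap (fun x : FermionTorus 2 L => fun i : Fin 2 => ((ofLex x i : ℕ) : ℤ))).Adj x y) (i : Fin 2) :
    -1 ≤ ((ofLex y i : ℕ) : ℤ) - ((ofLex x i : ℕ) : ℤ) ∧ ((ofLex y i : ℕ) : ℤ) - ((ofLex x i : ℕ) : ℤ) ≤ 1 := by
  rw [boxGraph_two_adj_iff] at h
  fin_cases i
  · show -1 ≤ ((ofLex y 0 : ℕ) : ℤ) - ((ofLex x 0 : ℕ) : ℤ) ∧ ((ofLex y 0 : ℕ) : ℤ) - ((ofLex x 0 : ℕ) : ℤ) ≤ 1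
    omega
  · show -1 ≤ ((ofLex y 1 : ℕ) : ℤ) - ((ofLex x 1 : ℕ) : ℤ) ∧ ((ofLex y 1 : ℕ) : ℤ) - ((ofLex x 1 : ℕ) : ℤ) ≤ 1
    omega

omit [NeZero L] in
/-- An integer identity of coordinates gives the torus-shift condition. [folklore] -/
theorem twR_shift_of_sub_eq {x y : FermionTorus 2 L} {e : Site 2} (hv : (fun i : Fin 2 => ((ofLex y i : ℕ) : ℤ)) - (fun i : Fin 2 => ((ofLex x i : ℕ) : ℤ)) = e) :
    FermionTorus.toTorusSite y = FermionTorus.toTorusSite x + Torus.proj L e := by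
  funext i
  have hi := congrFun hv i
  simp only [Pi.sub_apply] at hi
  simp only [FermionTorus.toTorusSite_apply, Pi.add_apply, Torus.proj_apply, ← hi]
  push_cast
  ring

/-- **Unit steps are incongruent mod `L ≥ 3`**: if the torus and box adjacencies of `(x, y)` agree, then
`y ≡ x + e (mod L)` iff `y - x = e`, for every unit step `e`. [folklore] -/
theorem twR_shift_iff_sub_eq (hL : 3 ≤ L) {x y : FermionTorus 2 L} (hiff : (fermionTorusGraph 2 L).Adj x y ↔ ((zdGraph 2).comap (fun x : FermionTorus 2 L => fun i : Fin 2 => ((ofLex x i : ℕ) : ℤ))).Adj x y)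
    {e : Site 2} (he : e ∈ unitSteps) :
    FermionTorus.ofTorusSite (FermionTorus.toTorusSite x + Torus.proj L e) = y ↔ (fun i : Fin 2 => ((ofLex y i : ℕ) : ℤ)) - (fun i : Fin 2 => ((ofLex x i : ℕ) : ℤ)) = e := by
  rw [twR_ofTorusSite_add_eq_iff]
  refine ⟨fun h => ?_, twR_shift_of_sub_eq⟩
  have hB := hiff.1 (twR_torusAdj_of_shift (by omega) he h)
  funext i
  have hvi := twR_boxAdj_apply hB i
  have hei := twR_unitSteps_apply he i
  -- the congruence `y_i ≡ x_i + e_i (mod L)`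
  have hc := congrFun h i
  simp only [FermionTorus.toTorusSite_apply, Pi.add_apply, Torus.proj_apply] at hc
  have hdvd : (L : ℤ) ∣ (((ofLex y i : ℕ) : ℤ) - ((ofLex x i : ℕ) : ℤ) - e i) := by
    refine (ZMod.intCast_zmod_eq_zero_iff_dvd _ L).1 ?_
    push_cast
    rw [hc]
    ring
  have hzero : ((ofLex y i : ℕ) : ℤ) - ((ofLex x i : ℕ) : ℤ) - e i = 0 :=
    Int.eq_zero_of_dvd_of_natAbs_lt_natAbs hdvd (by omega)
  simp only [Pi.sub_apply]
  omega

/-- **The bond weights of `Δ_d` are the box weights off the wrap-around pairs**: for `L ≥ 3`, if the torus and box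
adjacencies of `(x, y)` agree then `A_d(x,y) = ĝ_d(y - x)/√2`. [folklore] -/
theorem twR_pairWeight_eq_of_adj_iff (hL : 3 ≤ L) (z : FermionTorus 2 L × FermionTorus 2 L)
    (hiff : (fermionTorusGraph 2 L).Adj z.1 z.2 ↔ ((zdGraph 2).comap (fun x : FermionTorus 2 L => fun i : Fin 2 => ((ofLex x i : ℕ) : ℤ))).Adj z.1 z.2) : (fun z : FermionTorus 2 L × FermionTorus 2 L => ∑ e ∈ insert (0 : Site 2) unitSteps, (if FermionTorus.ofTorusSite (FermionTorus.toTorusSite z.1 + Torus.proj L e) = z.2 then ((dWaveFormFactor e / Real.sqrt 2 : ℝ) : ℂ) else 0)) z = (fun z : FermionTorus 2 L × FermionTorus 2 L => (((dWaveFormFactor ((fun i : Fin 2 => ((ofLex z.2 i : ℕ) : ℤ)) - (fun i : Fin 2 => ((ofLex z.1 i : ℕ) : ℤ))) / Real.sqrt 2 : ℝ) : ℂ))) z := by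
  show (∑ e ∈ insert (0 : Site 2) unitSteps, (if FermionTorus.ofTorusSite (FermionTorus.toTorusSite z.1 + Torus.proj L e) = z.2
      then ((dWaveFormFactor e / Real.sqrt 2 : ℝ) : ℂ) else 0)) = (((dWaveFormFactor ((fun i : Fin 2 => ((ofLex z.2 i : ℕ) : ℤ)) - (fun i : Fin 2 => ((ofLex z.1 i : ℕ) : ℤ))) / Real.sqrt 2 : ℝ) : ℂ))
  -- `0 ∉ unitSteps` (the tree's `zero_not_mem_unitSteps`, inlined to keep the import cone small)
  have h0 : (0 : Site 2) ∉ unitSteps := by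
    have h0a : (0 : Site 2) ≠ Pi.single 0 1 := fun h => by simpa using congrFun h 0
    have h0b : (0 : Site 2) ≠ -Pi.single 0 1 := fun h => by simpa using congrFun h 0
    have h0c : (0 : Site 2) ≠ Pi.single 1 1 := fun h => by simpa using congrFun h 1
    have h0d : (0 : Site 2) ≠ -Pi.single 1 1 := fun h => by simpa using congrFun h 1
    simp [unitSteps, h0a, h0b, h0c, h0d]
  rw [Finset.sum_insert h0, dWaveFormFactor_zero, zero_div, Complex.ofReal_zero, ite_self, zero_add,
    twR_dWaveKernel_eq_sum]
  refine Finset.sum_congr rfl fun e he => ?_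
  by_cases hc : FermionTorus.ofTorusSite (FermionTorus.toTorusSite z.1 + Torus.proj L e) = z.2
  · rw [if_pos hc, if_pos ((twR_shift_iff_sub_eq hL hiff he).1 hc)]
  · rw [if_neg hc, if_neg (mt (twR_shift_iff_sub_eq hL hiff he).2 hc)]

/-- `‖A_d(z) - w_box(z)‖ ≤ 6 · 1[adjacencies disagree]`. [folklore] -/
theorem twR_norm_pairWeight_sub_le (hL : 3 ≤ L) (z : FermionTorus 2 L × FermionTorus 2 L) :
    ‖(fun z : FermionTorus 2 L × FermionTorus 2 L => ∑ e ∈ insert (0 : Site 2) unitSteps, (if FermionTorus.ofTorusSite (FermionTorus.toTorusSite z.1 + Torus.proj L e) = z.2 then ((dWaveFormFactor e / Real.sqrt 2 : ℝ) : ℂ) else 0)) z - (fun z : FermionTorus 2 L × FermionTorus 2 L => (((dWaveFormFactor ((fun i : Fin 2 => ((ofLex z.2 i : ℕ) : ℤ)) - (fun i : Fin 2 => ((ofLex z.1 i : ℕ) : ℤ))) / Real.sqrt 2 : ℝ) : ℂ))) z‖ ≤ if ¬ ((fermionTorusGraph 2 L).Adj z.1 z.2 ↔ ((zdGraph 2).comap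 (fun x : FermionTorus 2 L => fun i : Fin 2 => ((ofLex x i : ℕ) : ℤ))).Adj z.1 z.2) then 6 else 0 := by
  by_cases hm : ((fermionTorusGraph 2 L).Adj z.1 z.2 ↔ ((zdGraph 2).comap (fun x : FermionTorus 2 L => fun i : Fin 2 => ((ofLex x i : ℕ) : ℤ))).Adj z.1 z.2)
  · rw [if_neg (not_not_intro hm), twR_pairWeight_eq_of_adj_iff hL z hm, sub_self, norm_zero]
  · rw [if_pos hm]
    calc ‖(fun z : FermionTorus 2 L × FermionTorus 2 L => ∑ e ∈ insert (0 : Site 2) unitSteps, (if FermionTorus.ofTorusSite (FermionTorus.toTorusSite z.1 + Torus.proj L e) = z.2 then ((dWaveFormFactor e / Real.sqrt 2 : ℝ) : ℂ) else 0)) z - (fun z : FermionTorus 2 L × FermionTorus 2 L => (((dWaveFormFactor ((fun i : Fin 2 => ((ofLex z.2 i : ℕ) : ℤ)) - (fun i : Fin 2 => ((ofLex z.1 i : ℕ) : ℤ))) / Real.sqrt 2 : ℝ) : ℂ))) z‖ ≤ ‖(fun z : FermionTorus 2 L × FermionTorus 2 L => ∑ e ∈ insert (0 : Site 2) unitSteps,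 (if FermionTorus.ofTorusSite (FermionTorus.toTorusSite z.1 + Torus.proj L e) = z.2 then ((dWaveFormFactor e / Real.sqrt 2 : ℝ) : ℂ) else 0)) z‖ + ‖(fun z : FermionTorus 2 L × FermionTorus 2 L => (((dWaveFormFactor ((fun i : Fin 2 => ((ofLex z.2 i : ℕ) : ℤ)) - (fun i : Fin 2 => ((ofLex z.1 i : ℕ) : ℤ))) / Real.sqrt 2 : ℝ) : ℂ))) z‖ := norm_sub_le _ _
      _ ≤ 5 + 1 := add_le_add (twR_norm_pairWeight_le L z) (twR_dWaveKernel_norm_le _)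
      _ = 6 := by norm_num

/-- **`‖Δ_d - P_box‖ ≤ 48L`** for `L ≥ 3`. [folklore] -/
theorem twR_norm_pairField_sub_box_le (hL : 3 ≤ L) : ‖pairField dWaveFormFactor L - (∑ z : FermionTorus 2 L × FermionTorus 2 L, (fun z : FermionTorus 2 L × FermionTorus 2 L => (((dWaveFormFactor ((fun i : Fin 2 => ((ofLex z.2 i : ℕ) : ℤ)) - (fun i : Fin 2 => ((ofLex z.1 i : ℕ) : ℤ))) / Real.sqrt 2 : ℝ) : ℂ))) z • bondPair z.1 z.2)‖ ≤ 48 * L := by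
  rw [twR_pairField_eq_sum_bondPair dWaveFormFactor L, ← Finset.sum_sub_distrib]
  have hsub : ∀ z : FermionTorus 2 L × FermionTorus 2 L, (fun z : FermionTorus 2 L × FermionTorus 2 L => ∑ e ∈ insert (0 : Site 2) unitSteps, (if FermionTorus.ofTorusSite (FermionTorus.toTorusSite z.1 + Torus.proj L e) = z.2 then ((dWaveFormFactor e / Real.sqrt 2 : ℝ) : ℂ) else 0)) z • bondPair z.1 z.2 - (fun z : FermionTorus 2 L × FermionTorus 2 L => (((dWaveFormFactor ((fun i : Fin 2 => ((ofLex z.2 i : ℕ) : ℤ)) - (fun i : Fin 2 => ((ofLex z.1 i : ℕ) : ℤ))) / Real.sqrt 2 : ℝ) : ℂ))) z • bondPair z.1 z.2 =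
      ((fun z : FermionTorus 2 L × FermionTorus 2 L => ∑ e ∈ insert (0 : Site 2) unitSteps, (if FermionTorus.ofTorusSite (FermionTorus.toTorusSite z.1 + Torus.proj L e) = z.2 then ((dWaveFormFactor e / Real.sqrt 2 : ℝ) : ℂ) else 0)) z - (fun z : FermionTorus 2 L × FermionTorus 2 L => (((dWaveFormFactor ((fun i : Fin 2 => ((ofLex z.2 i : ℕ) : ℤ)) - (fun i : Fin 2 => ((ofLex z.1 i : ℕ) : ℤ))) / Real.sqrt 2 : ℝ) : ℂ))) z) • bondPair z.1 z.2 := fun z => by rw [sub_smul]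
  simp_rw [hsub]
  have h1 := twR_norm_sum_smul_le Finset.univ (fun z : FermionTorus 2 L × FermionTorus 2 L => (fun z : FermionTorus 2 L × FermionTorus 2 L => ∑ e ∈ insert (0 : Site 2) unitSteps, (if FermionTorus.ofTorusSite (FermionTorus.toTorusSite z.1 + Torus.proj L e) = z.2 then ((dWaveFormFactor e / Real.sqrt 2 : ℝ) : ℂ) else 0)) z - (fun z : FermionTorus 2 L × FermionTorus 2 L => (((dWaveFormFactor ((fun i : Fin 2 => ((ofLex z.2 i : ℕ) : ℤ)) - (fun i : Fin 2 => ((ofLex z.1 i : ℕ) : ℤ))) / Real.sqrt 2 : ℝ) : ℂ))) z)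
    (fun z => bondPair z.1 z.2) (fun z _ => norm_bondPair_le_two _ _)
  refine h1.trans ?_
  have h2 : ∑ z : FermionTorus 2 L × FermionTorus 2 L, ‖(fun z : FermionTorus 2 L × FermionTorus 2 L => ∑ e ∈ insert (0 : Site 2) unitSteps, (if FermionTorus.ofTorusSite (FermionTorus.toTorusSite z.1 + Torus.proj L e) = z.2 then ((dWaveFormFactor e / Real.sqrt 2 : ℝ) : ℂ) else 0)) z - (fun z : FermionTorus 2 L × FermionTorus 2 L => (((dWaveFormFactor ((fun i : Fin 2 => ((ofLex z.2 i : ℕ) : ℤ)) - (fun i : Fin 2 => ((ofLex z.1 i : ℕ) : ℤ))) / Real.sqrt 2 : ℝ) : ℂ))) z‖ ≤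
      6 * (((Finset.univ : Finset (FermionTorus 2 L × FermionTorus 2 L)).filter
        (fun z => ¬ ((fermionTorusGraph 2 L).Adj z.1 z.2 ↔ ((zdGraph 2).comap (fun x : FermionTorus 2 L => fun i : Fin 2 => ((ofLex x i : ℕ) : ℤ))).Adj z.1 z.2))).card : ℝ) := by
    calc ∑ z : FermionTorus 2 L × FermionTorus 2 L, ‖(fun z : FermionTorus 2 L × FermionTorus 2 L => ∑ e ∈ insert (0 : Site 2) unitSteps, (if FermionTorus.ofTorusSite (FermionTorus.toTorusSite z.1 + Torus.proj L e) = z.2 then ((dWaveFormFactor e / Real.sqrt 2 : ℝ) : ℂ) else 0)) z - (fun z : FermionTorus 2 L × FermionTorus 2 L => (((dWaveFormFactor ((fun i : Fin 2 => ((ofLex z.2 i : ℕ) : ℤ)) - (fun i : Fin 2 => ((ofLex z.1 i : ℕ) : ℤ))) / Real.sqrt 2 : ℝ) : ℂ))) z‖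
        ≤ ∑ z : FermionTorus 2 L × FermionTorus 2 L, (if ¬ ((fermionTorusGraph 2 L).Adj z.1 z.2 ↔ ((zdGraph 2).comap (fun x : FermionTorus 2 L => fun i : Fin 2 => ((ofLex x i : ℕ) : ℤ))).Adj z.1 z.2) then (6 : ℝ) else 0) :=
          Finset.sum_le_sum fun z _ => twR_norm_pairWeight_sub_le hL z
      _ = 6 * (((Finset.univ : Finset (FermionTorus 2 L × FermionTorus 2 L)).filter
          (fun z => ¬ ((fermionTorusGraph 2 L).Adj z.1 z.2 ↔ ((zdGraph 2).comap (fun x : FermionTorus 2 L => fun i : Fin 2 => ((ofLex x i : ℕ) : ℤ))).Adj z.1 z.2))).card : ℝ) := by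
          rw [← Finset.sum_filter, Finset.sum_const, nsmul_eq_mul, mul_comm]
  have h3 : (((Finset.univ : Finset (FermionTorus 2 L × FermionTorus 2 L)).filter
      (fun z => ¬ ((fermionTorusGraph 2 L).Adj z.1 z.2 ↔ ((zdGraph 2).comap (fun x : FermionTorus 2 L => fun i : Fin 2 => ((ofLex x i : ℕ) : ℤ))).Adj z.1 z.2))).card : ℝ) ≤ 4 * L := by
    exact_mod_cast card_filter_le_of_not_adj_iff
      (fun z : FermionTorus 2 L × FermionTorus 2 L => ¬ ((fermionTorusGraph 2 L).Adj z.1 z.2 ↔ ((zdGraph 2).comap (fun x : FermionTorus 2 L => fun i : Fin 2 => ((ofLex x i : ℕ) : ℤ))).Adj z.1 z.2)) (fun z hz => hz)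
  linarith

end Weights

/-! ### Torus versus box: Hamiltonians and free energies -/

section Comparison

variable {L : ℕ} [NeZero L]

/-- **`‖dWaveSourceTorus L U μ h - H_box‖ ≤ (8 + 96|h|)L`** for `L ≥ 3`. [folklore] -/
theorem twR_norm_dWaveSourceTorus_sub_box_le (hL : 3 ≤ L) (U μ h : ℝ) :
    ‖dWaveSourceTorus L U μ h - (hamiltonianWith ((zdGraph 2).comap (fun x : FermionTorus 2 L => fun i : Fin 2 => ((ofLex x i : ℕ) : ℤ))) 1 U μ - (h : ℂ) • ((∑ z : FermionTorus 2 L × FermionTorus 2 L, (fun z : FermionTorus 2 L × FermionTorus 2 L => (((dWaveFormFactor ((fun i : Fin 2 => ((ofLex z.2 i : ℕ) : ℤ)) - (fun i : Fin 2 => ((ofLex z.1 i : ℕ) : ℤ))) / Real.sqrt 2 : ℝ) : ℂ))) z • bondPair z.1 z.2) + (∑ z : FermionTorus 2 L × FermionTorus 2 L, (fun z : FermionTorus 2 L × FermionTorus 2 L => (((dWaveFormFactor ((fun i : Fin 2 => ((ofLex z.2 i : ℕ) : ℤ)) - (fun i : Fin 2 => ((ofLex z.1 i : ℕ) : ℤ)))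 / Real.sqrt 2 : ℝ) : ℂ))) z • bondPair z.1 z.2)ᴴ))‖ ≤ (8 + 96 * |h|) * L := by
  have hsplit : dWaveSourceTorus L U μ h - (hamiltonianWith ((zdGraph 2).comap (fun x : FermionTorus 2 L => fun i : Fin 2 => ((ofLex x i : ℕ) : ℤ))) 1 U μ - (h : ℂ) • ((∑ z : FermionTorus 2 L × FermionTorus 2 L, (fun z : FermionTorus 2 L × FermionTorus 2 L => (((dWaveFormFactor ((fun i : Fin 2 => ((ofLex z.2 i : ℕ) : ℤ)) - (fun i : Fin 2 => ((ofLex z.1 i : ℕ) : ℤ))) / Real.sqrt 2 : ℝ) : ℂ))) z • bondPair z.1 z.2) + (∑ z : FermionTorus 2 L × FermionTorus 2 L, (fun z : FermionTorus 2 L × FermionTorus 2 L => (((dWaveFormFactor ((fun i : Fin 2 => ((ofLex z.2 i : ℕ) : ℤ)) - (fun i : Fin 2 => ((ofLex z.1 i : ℕ) : ℤ))) / Real.sqrt 2 : ℝ) : ℂ))) z • bondPair z.1 z.2)ᴴ)) =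
      (hamiltonianWith (fermionTorusGraph 2 L) 1 U μ - hamiltonianWith ((zdGraph 2).comap (fun x : FermionTorus 2 L => fun i : Fin 2 => ((ofLex x i : ℕ) : ℤ))) 1 U μ) -
        (h : ℂ) • ((pairField dWaveFormFactor L - (∑ z : FermionTorus 2 L × FermionTorus 2 L, (fun z : FermionTorus 2 L × FermionTorus 2 L => (((dWaveFormFactor ((fun i : Fin 2 => ((ofLex z.2 i : ℕ) : ℤ)) - (fun i : Fin 2 => ((ofLex z.1 i : ℕ) : ℤ))) / Real.sqrt 2 : ℝ) : ℂ))) z • bondPair z.1 z.2)) + (pairField dWaveFormFactor L - (∑ z : FermionTorus 2 L × FermionTorus 2 L, (fun z : FermionTorus 2 L × FermionTorus 2 L => (((dWaveFormFactor ((fun i : Fin 2 => ((ofLex z.2 i : ℕ) : ℤ)) - (fun i : Fin 2 => ((ofLex z.1 i : ℕ) : ℤ))) / Real.sqrt 2 : ℝ) : ℂ))) z • bondPair z.1 z.2))ᴴ) := by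
    rw [dWaveSourceTorus, hubbardTorusWith]
    simp only [conjTranspose_sub, smul_add, smul_sub]
    abel
  rw [hsplit]
  have h1 := twR_norm_hamiltonianWith_torus_sub_box_le (L := L) U μ
  have h2 := twR_norm_pairField_sub_box_le (L := L) hL
  have h3 := twR_norm_add_conjTranspose_le (pairField dWaveFormFactor L - (∑ z : FermionTorus 2 L × FermionTorus 2 L, (fun z : FermionTorus 2 L × FermionTorus 2 L => (((dWaveFormFactor ((fun i : Fin 2 => ((ofLex z.2 i : ℕ) : ℤ)) - (fun i : Fin 2 => ((ofLex z.1 i : ℕ) : ℤ))) / Real.sqrt 2 : ℝ) : ℂ))) z • bondPair z.1 z.2))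
  calc ‖(hamiltonianWith (fermionTorusGraph 2 L) 1 U μ - hamiltonianWith ((zdGraph 2).comap (fun x : FermionTorus 2 L => fun i : Fin 2 => ((ofLex x i : ℕ) : ℤ))) 1 U μ) -
        (h : ℂ) • ((pairField dWaveFormFactor L - (∑ z : FermionTorus 2 L × FermionTorus 2 L, (fun z : FermionTorus 2 L × FermionTorus 2 L => (((dWaveFormFactor ((fun i : Fin 2 => ((ofLex z.2 i : ℕ) : ℤ)) - (fun i : Fin 2 => ((ofLex z.1 i : ℕ) : ℤ))) / Real.sqrt 2 : ℝ) : ℂ))) z • bondPair z.1 z.2)) + (pairField dWaveFormFactor L - (∑ z : FermionTorus 2 L × FermionTorus 2 L, (fun z : FermionTorus 2 L × FermionTorus 2 L => (((dWaveFormFactor ((fun i : Fin 2 => ((ofLex z.2 i : ℕ) : ℤ)) - (fun i : Fin 2 => ((ofLex z.1 i : ℕ) : ℤ))) / Real.sqrt 2 : ℝ) : ℂ))) z • bondPair z.1 z.2))ᴴ)‖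
      ≤ ‖hamiltonianWith (fermionTorusGraph 2 L) 1 U μ - hamiltonianWith ((zdGraph 2).comap (fun x : FermionTorus 2 L => fun i : Fin 2 => ((ofLex x i : ℕ) : ℤ))) 1 U μ‖ +
          ‖(h : ℂ) • ((pairField dWaveFormFactor L - (∑ z : FermionTorus 2 L × FermionTorus 2 L, (fun z : FermionTorus 2 L × FermionTorus 2 L => (((dWaveFormFactor ((fun i : Fin 2 => ((ofLex z.2 i : ℕ) : ℤ)) - (fun i : Fin 2 => ((ofLex z.1 i : ℕ) : ℤ))) / Real.sqrt 2 : ℝ) : ℂ))) z • bondPair z.1 z.2)) + (pairField dWaveFormFactor L - (∑ z : FermionTorus 2 L × FermionTorus 2 L, (fun z : FermionTorus 2 L × FermionTorus 2 L => (((dWaveFormFactor ((fun i : Fin 2 => ((ofLex z.2 i : ℕ) : ℤ)) - (fun i : Fin 2 => ((ofLex z.1 i : ℕ) : ℤ))) / Real.sqrt 2 : ℝ) : ℂ))) z • bondPair z.1 z.2))ᴴ)‖ := norm_sub_le _ _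
    _ ≤ 8 * L + |h| * (2 * (48 * L)) := by
        rw [norm_smul, Complex.norm_real, Real.norm_eq_abs]
        exact add_le_add h1 (mul_le_mul_of_nonneg_left (h3.trans (by linarith)) (abs_nonneg h))
    _ = (8 + 96 * |h|) * L := by ring

/-- **Boundary conditions cost `O(L)` in the free energy**: `|log Z_β(torus) - log Z_β(box)| ≤ β(8 + 96|h|)L`. [folklore] -/
theorem twR_abs_log_partitionFn_torus_sub_box_le (hL : 3 ≤ L) {β : ℝ} (hβ : 0 ≤ β) (U μ h : ℝ) :
    |Real.log (partitionFn β (dWaveSourceTorus L U μ h)).re - Real.log (partitionFn β (hamiltonianWith ((zdGraph 2).comap (fun x : FermionTorus 2 L => fun i : Fin 2 => ((ofLex x i : ℕ) : ℤ))) 1 U μ - (h : ℂ) • ((∑ z : FermionTorus 2 L × FermionTorus 2 L, (fun z : FermionTorus 2 L × FermionTorus 2 L => (((dWaveFormFactor ((fun i : Fin 2 => ((ofLex z.2 i : ℕ) : ℤ)) - (fun i : Fin 2 => ((ofLex z.1 i : ℕ) : ℤ))) / Real.sqrt 2 : ℝ) : ℂ))) z • bondPair z.1 z.2) + (∑ z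 : FermionTorus 2 L × FermionTorus 2 L, (fun z : FermionTorus 2 L × FermionTorus 2 L => (((dWaveFormFactor ((fun i : Fin 2 => ((ofLex z.2 i : ℕ) : ℤ)) - (fun i : Fin 2 => ((ofLex z.1 i : ℕ) : ℤ))) / Real.sqrt 2 : ℝ) : ℂ))) z • bondPair z.1 z.2)ᴴ))).re| ≤ β * ((8 + 96 * |h|) * L) := by
  have hT : (dWaveSourceTorus L U μ h).IsHermitian := dWaveSourceTorus_isHermitian L (isHermitian_hubbardTorusWith L 1 U μ) h
  have hB : ((hamiltonianWith ((zdGraph 2).comap (fun x : FermionTorus 2 L => fun i : Fin 2 => ((ofLex x i : ℕ) : ℤ))) 1 U μ - (h : ℂ) • ((∑ z : FermionTorus 2 L × FermionTorus 2 L, (fun z : FermionTorus 2 L × FermionTorus 2 L => (((dWaveFormFactor ((fun i : Fin 2 => ((ofLex z.2 i : ℕ) : ℤ)) - (fun i : Fin 2 => ((ofLex z.1 i : ℕ) : ℤ))) / Real.sqrt 2 : ℝ) : ℂ))) z • bondPair z.1 z.2) + (∑ z : FermionTorus 2 L × FermionTorus 2 L, (fun z : FermionTorus 2 L × FermionTorus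 2 L => (((dWaveFormFactor ((fun i : Fin 2 => ((ofLex z.2 i : ℕ) : ℤ)) - (fun i : Fin 2 => ((ofLex z.1 i : ℕ) : ℤ))) / Real.sqrt 2 : ℝ) : ℂ))) z • bondPair z.1 z.2)ᴴ))).IsHermitian := twR_sourced_isHermitian ((zdGraph 2).comap (fun x : FermionTorus 2 L => fun i : Fin 2 => ((ofLex x i : ℕ) : ℤ))) 1 U μ h (fun z : FermionTorus 2 L × FermionTorus 2 L => (((dWaveFormFactor ((fun i : Fin 2 => ((ofLex z.2 i : ℕ) : ℤ)) - (fun i : Fin 2 => ((ofLex z.1 i : ℕ) : ℤ))) / Real.sqrt 2 : ℝ) : ℂ)))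
  exact (abs_log_partitionFn_sub_log_partitionFn_le hT hB hβ).trans
    (mul_le_mul_of_nonneg_left (twR_norm_dWaveSourceTorus_sub_box_le hL U μ h) hβ)

end Comparison

/-! ### The thermodynamic limit of the sourced torus pressure -/

section Limit

/-- **Thermodynamic limit of the d-wave-sourced torus pressure** (registered stub `stub_sourcedPressureLimit` of crux
stmt-HubbardSuperconductivity-15581, line `Sketch`): for all real `β > 0`, `U`, `μ`, `h`, the finite-volume pressure
`log Re Z_β(dWaveSourceTorus L U μ h)/(βL²)` of the torus `(ℤ/Lℤ)²` converges as `L → ∞`. Proof: the free-boundary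
limit along squares (`twR_rect_logZ_density_tendsto` with the d-wave kernel), the identification of the free-boundary
box with the `L × L` rectangle (`twR_box_partitionFn_eq_rect`) and the `O(L)` boundary-condition estimate
(`twR_abs_log_partitionFn_torus_sub_box_le`). Ruelle (1969) §2.2–2.3. [folklore] -/
theorem stub_sourcedPressureLimit : ∀ (β U μ h : ℝ), 0 < β → ∃ q : ℝ, ∀ κ : ℝ, 0 < κ → ∃ L₀ : ℕ, ∀ (L : ℕ) [NeZero L], L₀ ≤ L → |Real.log (Matrix.partitionFn β (dWaveSourceTorus L U μ h)).re / (β * (L : ℝ) ^ 2) - q| ≤ κ := by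
  intro β U μ h hβ
  obtain ⟨q₀, hq₀⟩ := twR_rect_logZ_density_tendsto (fun v : Fin 2 → ℤ => ((dWaveFormFactor v / Real.sqrt 2 : ℝ) : ℂ)) twR_dWaveKernel_norm_le twR_dWaveKernel_adj hβ.le 1 U μ h
  refine ⟨q₀ / β, fun κ hκ => ?_⟩
  -- the free-boundary density along all squares
  have hF : Tendsto (fun m : ℕ => Real.log (partitionFn β (hamiltonianWith ((zdGraph 2).comap (fun p : (Lex (Fin m × Fin m)) => ![((ofLex p).1 : ℤ), ((ofLex p).2 : ℤ)])) 1 U μ - (h : ℂ) • ((∑ z : (Lex (Fin m × Fin m)) × (Lex (Fin m × Fin m)), (fun z : (Lex (Fin m × Fin m)) × (Lex (Fin m × Fin m)) => (fun v : Fin 2 → ℤ => ((dWaveFormFactor v / Real.sqrt 2 : ℝ) : ℂ)) (![((ofLex z.2).1 : ℤ), ((ofLex z.2).2 : ℤ)] - ![((ofLex z.1).1 : ℤ), ((ofLex z.1).2 : ℤ)])) z • bondPair z.1 z.2) + (∑ z : (Lex (Fin m × Fin m)) × (Lex (Fin m × Fin m)), (fun z : (Lex (Fin m × Fin m)) ×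 (Lex (Fin m × Fin m)) => (fun v : Fin 2 → ℤ => ((dWaveFormFactor v / Real.sqrt 2 : ℝ) : ℂ)) (![((ofLex z.2).1 : ℤ), ((ofLex z.2).2 : ℤ)] - ![((ofLex z.1).1 : ℤ), ((ofLex z.1).2 : ℤ)])) z • bondPair z.1 z.2)ᴴ))).re / ((m : ℕ) : ℝ) ^ 2) atTop (𝓝 q₀) :=
    (tendsto_add_atTop_iff_nat (f := fun m : ℕ => Real.log (partitionFn β (hamiltonianWith ((zdGraph 2).comap (fun p : (Lex (Fin m × Fin m)) => ![((ofLex p).1 : ℤ), ((ofLex p).2 : ℤ)])) 1 U μ - (h : ℂ) • ((∑ z : (Lex (Fin m × Fin m)) × (Lex (Fin m × Fin m)), (fun z : (Lex (Fin m × Fin m)) × (Lex (Fin m × Fin m)) => (fun v : Fin 2 → ℤ => ((dWaveFormFactor v / Real.sqrt 2 : ℝ) : ℂ)) (![((ofLex z.2).1 : ℤ), ((ofLex z.2).2 : ℤ)] - ![((ofLex z.1).1 : ℤ), ((ofLex z.1).2 : ℤ)])) z • bondPair z.1 z.2) + (∑ z : (Lex (Fin m × Fin m)) × (Lex (Fin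 m × Fin m)), (fun z : (Lex (Fin m × Fin m)) × (Lex (Fin m × Fin m)) => (fun v : Fin 2 → ℤ => ((dWaveFormFactor v / Real.sqrt 2 : ℝ) : ℂ)) (![((ofLex z.2).1 : ℤ), ((ofLex z.2).2 : ℤ)] - ![((ofLex z.1).1 : ℤ), ((ofLex z.1).2 : ℤ)])) z • bondPair z.1 z.2)ᴴ))).re / ((m : ℕ) : ℝ) ^ 2) 1).1 hq₀
  -- the total error `(8 + 96|h|)/L + |F L - q₀|/β` tends to zero
  have hG : Tendsto (fun m : ℕ => (8 + 96 * |h|) / ((m : ℕ) : ℝ) + |Real.log (partitionFn β (hamiltonianWith ((zdGraph 2).comap (fun p : (Lex (Fin m × Fin m)) => ![((ofLex p).1 : ℤ), ((ofLex p).2 : ℤ)])) 1 U μ - (h : ℂ) • ((∑ z : (Lex (Fin m × Fin m)) × (Lex (Fin m × Fin m)), (fun z : (Lex (Fin m × Fin m)) × (Lex (Fin m × Fin m)) => (fun v : Fin 2 → ℤ => ((dWaveFormFactor v / Real.sqrt 2 : ℝ) : ℂ)) (![((ofLex z.2).1 : ℤ), ((ofLex z.2).2 : ℤ)] - ![((ofLex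 z.1).1 : ℤ), ((ofLex z.1).2 : ℤ)])) z • bondPair z.1 z.2) + (∑ z : (Lex (Fin m × Fin m)) × (Lex (Fin m × Fin m)), (fun z : (Lex (Fin m × Fin m)) × (Lex (Fin m × Fin m)) => (fun v : Fin 2 → ℤ => ((dWaveFormFactor v / Real.sqrt 2 : ℝ) : ℂ)) (![((ofLex z.2).1 : ℤ), ((ofLex z.2).2 : ℤ)] - ![((ofLex z.1).1 : ℤ), ((ofLex z.1).2 : ℤ)])) z • bondPair z.1 z.2)ᴴ))).re / ((m : ℕ) : ℝ) ^ 2 - q₀| / β) atTop (𝓝 0) := by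
    have h1 : Tendsto (fun m : ℕ => (8 + 96 * |h|) / ((m : ℕ) : ℝ)) atTop (𝓝 0) := tendsto_const_div_atTop_nhds_zero_nat _
    have h2 : Tendsto (fun m : ℕ => |Real.log (partitionFn β (hamiltonianWith ((zdGraph 2).comap (fun p : (Lex (Fin m × Fin m)) => ![((ofLex p).1 : ℤ), ((ofLex p).2 : ℤ)])) 1 U μ - (h : ℂ) • ((∑ z : (Lex (Fin m × Fin m)) × (Lex (Fin m × Fin m)), (fun z : (Lex (Fin m × Fin m)) × (Lex (Fin m × Fin m)) => (fun v : Fin 2 → ℤ => ((dWaveFormFactor v / Real.sqrt 2 : ℝ) : ℂ)) (![((ofLex z.2).1 : ℤ), ((ofLex z.2).2 : ℤ)] - ![((ofLex z.1).1 : ℤ), ((ofLex z.1).2 : ℤ)])) z • bondPair z.1 z.2) + (∑ z : (Lex (Fin m × Fin m)) × (Lex (Fin m × Fin m)), (fun z : (Lex (Fin m × Fin m)) × (Lex (Fin m × Fin m)) => (fun v : Fin 2 → ℤ => ((dWaveFormFactor v / Real.sqrt 2 : ℝ) : ℂ)) (![((ofLex z.2).1 : ℤ), ((ofLex z.2).2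 : ℤ)] - ![((ofLex z.1).1 : ℤ), ((ofLex z.1).2 : ℤ)])) z • bondPair z.1 z.2)ᴴ))).re / ((m : ℕ) : ℝ) ^ 2 - q₀| / β) atTop (𝓝 0) := by
      have h3 : Tendsto (fun m : ℕ => Real.log (partitionFn β (hamiltonianWith ((zdGraph 2).comap (fun p : (Lex (Fin m × Fin m)) => ![((ofLex p).1 : ℤ), ((ofLex p).2 : ℤ)])) 1 U μ - (h : ℂ) • ((∑ z : (Lex (Fin m × Fin m)) × (Lex (Fin m × Fin m)), (fun z : (Lex (Fin m × Fin m)) × (Lex (Fin m × Fin m)) => (fun v : Fin 2 → ℤ => ((dWaveFormFactor v / Real.sqrt 2 : ℝ) : ℂ)) (![((ofLex z.2).1 : ℤ), ((ofLex z.2).2 : ℤ)] - ![((ofLex z.1).1 : ℤ), ((ofLex z.1).2 : ℤ)])) z • bondPair z.1 z.2) + (∑ z : (Lex (Fin m × Fin m)) × (Lex (Fin m × Fin m)), (fun z : (Lex (Fin m × Fin m)) × (Lex (Fin m × Fin m)) => (fun v : Fin 2 → ℤ => ((dWaveFormFactor v / Real.sqrt 2 : ℝ) : ℂ)) (![((ofLex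 z.2).1 : ℤ), ((ofLex z.2).2 : ℤ)] - ![((ofLex z.1).1 : ℤ), ((ofLex z.1).2 : ℤ)])) z • bondPair z.1 z.2)ᴴ))).re / ((m : ℕ) : ℝ) ^ 2 - q₀) atTop (𝓝 0) := by
        have := hF.sub_const q₀
        rwa [sub_self] at this
      have h4 := (continuous_abs.tendsto 0).comp h3
      rw [Function.comp_def, abs_zero] at h4
      simpa using h4.div_const β
    simpa using h1.add h2
  obtain ⟨N, hN⟩ := Filter.eventually_atTop.1 (hG.eventually (gt_mem_nhds hκ))
  refine ⟨max 3 N, fun L _ hL => ?_⟩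
  have hL3 : 3 ≤ L := le_of_max_le_left hL
  have hLN : N ≤ L := le_of_max_le_right hL
  have hLpos : (0 : ℝ) < L := by exact_mod_cast (show 0 < L by omega)
  have hL2 : (0 : ℝ) < (L : ℝ) ^ 2 := by positivity
  -- torus versus box versus rectangle
  have hbox := twR_abs_log_partitionFn_torus_sub_box_le (L := L) hL3 hβ.le U μ h
  rw [twR_box_partitionFn_eq_rect L β U μ h] at hbox
  set a := Real.log (Matrix.partitionFn β (dWaveSourceTorus L U μ h)).re with ha
  set b := Real.log (partitionFn β (hamiltonianWith ((zdGraph 2).comap (fun p : (Lex (Fin L × Fin L)) => ![((ofLex p).1 : ℤ), ((ofLex p).2 : ℤ)])) 1 U μ - (h : ℂ) • ((∑ z : (Lex (Fin L × Fin L)) × (Lex (Fin L × Fin L)), (fun z : (Lex (Fin L × Fin L)) × (Lex (Fin L × Fin L)) => (fun v : Fin 2 → ℤ => ((dWaveFormFactor v / Real.sqrt 2 : ℝ) : ℂ)) (![((ofLex z.2).1 : ℤ), ((ofLex z.2).2 : ℤ)] - ![((ofLex z.1).1 : ℤ), ((ofLex z.1).2 : ℤ)])) z • bondPair z.1 z.2)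 + (∑ z : (Lex (Fin L × Fin L)) × (Lex (Fin L × Fin L)), (fun z : (Lex (Fin L × Fin L)) × (Lex (Fin L × Fin L)) => (fun v : Fin 2 → ℤ => ((dWaveFormFactor v / Real.sqrt 2 : ℝ) : ℂ)) (![((ofLex z.2).1 : ℤ), ((ofLex z.2).2 : ℤ)] - ![((ofLex z.1).1 : ℤ), ((ofLex z.1).2 : ℤ)])) z • bondPair z.1 z.2)ᴴ))).re with hb
  have hGL := hN L hLN
  -- `|a/(βL²) - q₀/β| = |a/L² - q₀|/β ≤ (|a - b|/L² + |b/L² - q₀|)/β`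
  have e1 : a / (β * (L : ℝ) ^ 2) - q₀ / β = (a / (L : ℝ) ^ 2 - q₀) / β := by
    field_simp
  have e2 : a / (L : ℝ) ^ 2 - q₀ = (a - b) / (L : ℝ) ^ 2 + (b / (L : ℝ) ^ 2 - q₀) := by
    field_simp
    ring
  rw [e1, abs_div, abs_of_pos hβ, div_le_iff₀ hβ, e2]
  have h1 : |(a - b) / (L : ℝ) ^ 2| ≤ β * (8 + 96 * |h|) / L := by
    rw [abs_div, abs_of_pos hL2, div_le_div_iff₀ hL2 hLpos]
    calc |a - b| * L ≤ β * ((8 + 96 * |h|) * L) * L := mul_le_mul_of_nonneg_right hbox hLpos.le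
      _ = β * (8 + 96 * |h|) * (L : ℝ) ^ 2 := by ring
  have h2 := abs_add_le ((a - b) / (L : ℝ) ^ 2) (b / (L : ℝ) ^ 2 - q₀)
  have h3 : (8 + 96 * |h|) / (L : ℝ) + |b / (L : ℝ) ^ 2 - q₀| / β < κ := hGL
  rw [div_add_div _ _ hLpos.ne' hβ.ne', div_lt_iff₀ (mul_pos hLpos hβ)] at h3
  have h4 : |(a - b) / (L : ℝ) ^ 2| * L ≤ β * (8 + 96 * |h|) := by
    rw [← le_div_iff₀ hLpos]; exact h1
  nlinarith [h1, h2, h3, h4, abs_nonneg ((a - b) / (L : ℝ) ^ 2), abs_nonneg (b / (L : ℝ) ^ 2 - q₀), hLpos, hβ]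

end Limit

end Summit.HubbardSuperconductivity.HubbardSuperconductivity.Theorems

end
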